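import Literature.Geometry.DiscreteGeometry.EnergyLinearProgrammingBound

/-!
# Sharp LP bound for the inverse-square energy of 6 points on S² (octahedron)

Framing: lottery ticket; floor = certified bounds/negative ranges. Venture `PackingBounds` (cell
`pub-packcert`, seat `pub-packcert-energy`), energy-minimisation family, **+ control**.

**Theorem.** Every `6`-point configuration `C ⊂ S^2` of unit vectors of `ℝ^3` has `Σ_{x ≠ y ∈ C}
|x - y|^(-2) ≥ 27/2` (ordered pairs, the convention of Cohn–Kumar 2007). The bound is SHARP:
`27/2` is the exact `|x-y|^(-2)`-energy of the regular octahedron (6 points in S²) (inner products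
`-1, 0` with multiplicities `[1, 4]` seen from each point), which is universally optimal by
Cohn–Kumar 2007, Thm. 1.2; that equality is checked in exact rational arithmetic in the cell's
pipeline (`code/energy_cert.py`, verifier `code/energy_verify_a.py`), not in this file.

Proof: the linear programming bound for energy
(`Literature.Geometry.DiscreteGeometry.EnergyLP.energy_ge`, Yudin 1992 / Cohn–Kumar 2007 Prop.
4.1) applied to the Hermite-interpolation certificate `h = Σ_k α_k C_k^(1 / 2)` of degree `2` with
`α = (7/12, 1/2, 1/6)`, all `≥ 0`, and the kernel-checked polynomial identity `1 - (2 - 2t) h(t) =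
1/2 · W(t)` with `W(t) = (t + 1) * t ^ 2` manifestly `≥ 0` on `[-1, 1]`, so that `h(t) ≤ (2 -
2t)^(-1) = |x - y|^(-2)` at `t = ⟨x, y⟩ ∈ [-1, 1)`; finally `6² α_0 - 6 h(1) = 27/2` exactly.

## References
* H. Cohn, A. Kumar, *Universally optimal distribution of points on spheres*, J. Amer. Math. Soc.
20 (2007) 99–148, Thm. 1.2, Prop. 4.1, §§5–6. [`CohnKumar2006`]
* V. A. Yudin, Discrete Math. Appl. 3 (1993) 75–81. [`Yudin1993`]
-/

namespace Summit.Ventures.PackingBounds.Energy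

open Finset Literature.Analysis.SpecialFunctions Literature.Geometry.DiscreteGeometry

open scoped Classical in
/-- **Sharp LP lower bound for the `|x-y|^(-2)`-energy of `6` points on `S^2`**: `Σ_{x ≠ y} |x -
y|^(-2) ≥ 27/2`, attained by the regular octahedron (6 points in S²). Certificate: Hermite
interpolant of `t ↦ (2-2t)^(-1)` at the inner products of the configuration, degree `2`,
nonnegative Gegenbauer coefficients (Cohn–Kumar 2007 §§5–6). [cite: CohnKumar2006, Theorem 1.2
and Proposition 4.1] -/
theorem riesz2_energy_card6_ge (C : Finset (EuclideanSpace ℝ (Fin 3)))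
    (h1 : ∀ x ∈ C, ‖x‖ = 1) (hN : C.card = 6) :
    (27 / 2 : ℝ) ≤ ∑ x ∈ C, ∑ y ∈ C.erase x, (‖x - y‖ ^ 2)⁻¹ := by
  have hα : ∀ k : ℕ, (0 : ℝ) ≤ (fun k => match k with
        | 0 => 7 / 12 | 1 => 1 / 2 | 2 => 1 / 6 | _ => 0) k := by
    intro k
    dsimp only
    split <;> norm_num
  have hH : ∀ t : ℝ, -1 ≤ t → t < 1 →
      ∑ k ∈ range (2 + 1), (fun k => match k with
        | 0 => 7 / 12 | 1 => 1 / 2 | 2 => 1 / 6 | _ => 0) k * gegenbauerSum (1 / 2 : ℝ) k t ≤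
        (fun r : ℝ => r⁻¹) (2 - 2 * t) := by
    intro t ht1 ht2
    have hsum : ∑ k ∈ range (2 + 1), (fun k => match k with
        | 0 => 7 / 12 | 1 => 1 / 2 | 2 => 1 / 6 | _ => 0) k * gegenbauerSum (1 / 2 : ℝ) k t =
        1 / 2 + 1 / 2 * t + 1 / 4 * t ^ 2 := by
      simp [Finset.sum_range_succ, gegenbauerSum, gegenbauerCoeff, Finset.prod_range_succ,
        Nat.factorial]
      ring
    rw [hsum]
    have hpos : (0 : ℝ) < 2 - 2 * t := by linarith
    have ht0 : (0 : ℝ) ≤ t + 1 := by linarith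
    show _ ≤ (2 - 2 * t)⁻¹
    rw [inv_eq_one_div, le_div_iff₀ hpos]
    have hid : (1 / 2 + 1 / 2 * t + 1 / 4 * t ^ 2) * (2 - 2 * t) =
        1 - 1 / 2 *
          ((t + 1) * t ^ 2) := by
      ring
    have hW : (0 : ℝ) ≤
          (t + 1) * t ^ 2 :=
      (mul_nonneg ht0
        (sq_nonneg (t : ℝ)))
    rw [hid]
    nlinarith [hW, ht0]
  have key := EnergyLP.energy_ge (n := 3) (μ := 1 / 2) (by norm_num) (by norm_num) 2
    (fun k => match k with
        | 0 => 7 / 12 | 1 => 1 / 2 | 2 => 1 / 6 | _ => 0) hα (fun r : ℝ => r⁻¹) hH C h1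
  rw [hN] at key
  refine le_trans (le_of_eq ?_) key
  norm_num [Finset.sum_range_succ, gegenbauerSum, gegenbauerCoeff, Finset.prod_range_succ,
    Nat.factorial]

end Summit.Ventures.PackingBounds.Energy
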